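import Summits.BirchSwinnertonDyer.Rank2.ToyRankThreeLocalRootNumbers
import Literature.NumberTheory.EllipticCurves.BSDRootNumberPrimesEquivProofs
import HarnessLib

/-!
# Split versus non-split multiplicative reduction of an INTEGER model over `ℚ`, read on integer roots of the
# node-tangent quadratic modulo `p`

Cell `bsd-rank2` (D-0036), seat `bsd-rank2-eng` GEN 8 — kernel for the T-r3₂ support `RootNumberFacts` (local root
numbers of p2's `8-15-17` family), generalising `toy_hasSplitMultiplicativeReductionAt_iff` of
`Rank2/ToyRankThreeLocalRootNumbers.lean` (eng-2 GEN 4) from the toy curve to an arbitrary integer model.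

For `W₀ : WeierstrassCurve ℤ` with `W₀ ⊗ ℚ` elliptic, a finite place `v` of `ℤ` with prime `p` below it, `p ∣ Δ(W₀)`
and `p ∤ c₄(W₀)` (so `W₀` is `v`-minimal with multiplicative reduction):

* `integralModel_baseChange_eq_map` — Mathlib's integral model of `(W₀ ⊗ ℚ) ⊗ ℚ_v` over `O_v` IS `W₀` mapped along
  `ℤ → O_v` (injectivity of `O_v → ℚ_v`);
* `hasSplitMultiplicativeReductionAt_int_iff_exists_root` — **`W₀ ⊗ ℚ` has SPLIT multiplicative reduction at `v`
  iff the integer node-tangent quadratic `c₄T² + a₁c₄T − (54b₆ − 3b₂b₄ + a₂c₄)` has a root modulo `p`**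
  (`∃ t : ℤ, p ∣ …`): Mathlib's definition asks for the quadratic of the integral model to split over the residue
  field `κ(O_v)`, and `ℤ → κ(O_v)` is onto with kernel `(p)` (tree `residue_comp_algebraMap_surjective`,
  `ker_residue_comp_algebraMap`);
* `exists_root_iff_isSquare_disc` — for an odd prime `p ∤ c₄`, an integer root mod `p` exists iff the discriminant
  `c₄²·a₁² + 4c₄(54b₆ − 3b₂b₄ + a₂c₄)` is a square in `ZMod p` (completing the square).

THEOREMS ONLY; no `sorry`; standard axioms. PARTITION: none — r_an ≥ 2, summit axis S0; TWIN (D-0056): n/a. B1 honesty: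
local reduction bookkeeping; no S0 motion.

References: J. H. Silverman, *AEC* (2009) VII.5 Prop. 5.1(b), VII.1 Rem. 1.1 [SilvermanAEC2009]; D. Rohrlich,
*Compositio Math.* 87 (1993) Prop. 2(ii) [Rohrlich1993Compositio].
-/

set_option linter.dupNamespace false

noncomputable section

open IsDedekindDomain IsDedekindDomain.HeightOneSpectrum WeierstrassCurve Polynomial
  Rat.HeightOneSpectrum Literature.NumberTheory.EllipticCurves

namespace Summit.BirchSwinnertonDyer.Rank2

variable (W₀ : WeierstrassCurve ℤ) (v : HeightOneSpectrum ℤ)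

/-- The integral model over `O_v` of `(W₀ ⊗ ℚ) ⊗ ℚ_v` is `W₀` mapped along `ℤ → O_v`. [folklore] -/
theorem integralModel_baseChange_eq_map
    [((W₀.baseChange ℚ).baseChange (v.adicCompletion ℚ)).IsIntegral (v.adicCompletionIntegers ℚ)] :
    ((W₀.baseChange ℚ).baseChange (v.adicCompletion ℚ)).integralModel (v.adicCompletionIntegers ℚ) =
      W₀.map (algebraMap ℤ (v.adicCompletionIntegers ℚ)) := by
  set O := v.adicCompletionIntegers ℚ
  set K := v.adicCompletion ℚ with hK
  have inj := IsFractionRing.injective O K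
  have hc : ∀ z : ℤ, algebraMap O K (algebraMap ℤ O z) = (z : K) := fun z ↦ by
    rw [← IsScalarTower.algebraMap_apply, eq_intCast]
  have hq : ∀ z : ℤ, algebraMap ℚ K (algebraMap ℤ ℚ z) = (z : K) := fun z ↦ by
    rw [eq_intCast, map_intCast]
  refine WeierstrassCurve.ext ?_ ?_ ?_ ?_ ?_
  · exact inj (by rw [integralModel_a₁_eq, map_a₁, hc]; simp only [WeierstrassCurve.baseChange, map_a₁]; exact hq _)
  · exact inj (by rw [integralModel_a₂_eq, map_a₂, hc]; simp only [WeierstrassCurve.baseChange, map_a₂]; exact hq _)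
  · exact inj (by rw [integralModel_a₃_eq, map_a₃, hc]; simp only [WeierstrassCurve.baseChange, map_a₃]; exact hq _)
  · exact inj (by rw [integralModel_a₄_eq, map_a₄, hc]; simp only [WeierstrassCurve.baseChange, map_a₄]; exact hq _)
  · exact inj (by rw [integralModel_a₆_eq, map_a₆, hc]; simp only [WeierstrassCurve.baseChange, map_a₆]; exact hq _)

/-- **Split iff an integer root of the node-tangent quadratic exists mod `p`**, for an integer model `W₀` with
`p ∣ Δ`, `p ∤ c₄` at the place `v` above `p`. [cite: SilvermanAEC2009, VII.5 Prop. 5.1(b)] -/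
theorem hasSplitMultiplicativeReductionAt_int_iff_exists_root [(W₀.baseChange ℚ).IsElliptic]
    (hΔ : (natGenerator v : ℤ) ∣ W₀.Δ) (hc₄ : ¬ (natGenerator v : ℤ) ∣ W₀.c₄) :
    (W₀.baseChange ℚ).HasSplitMultiplicativeReductionAt v ↔
      ∃ t : ℤ, (natGenerator v : ℤ) ∣
        W₀.c₄ * t ^ 2 + W₀.a₁ * W₀.c₄ * t - (54 * W₀.b₆ - 3 * W₀.b₂ * W₀.b₄ + W₀.a₂ * W₀.c₄) := by
  set E := W₀.baseChange ℚ with hE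
  set O := v.adicCompletionIntegers ℚ with hO
  set K := v.adicCompletion ℚ with hK
  set EK := E.baseChange K with hEK
  have hval_c₄ : v.valuation ℚ E.c₄ = 1 := by
    rw [hE, baseChange_int_c₄]
    exact (Literature.NumberTheory.EllipticCurves.Rat.valuation_intCast_eq_one_iff v _).mpr hc₄
  have hval_Δ : v.valuation ℚ E.Δ < 1 := by
    rw [hE, baseChange_int_Δ]
    exact (Literature.NumberTheory.EllipticCurves.Rat.valuation_intCast_lt_one_iff v _).mpr hΔ
  have hW : E.IsIntegralAt v := isIntegralAt_baseChange_int v W₀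
  have hmult : E.HasMultiplicativeReductionAt v := hasMultiplicativeReductionAt_of_valuation_c₄_eq_one hW hval_c₄ hval_Δ
  haveI hmin : EK.IsMinimal O :=
    isMinimalAt_of_lt_valuation_c₄ hW
      (by rw [hval_c₄, ← WithZero.exp_zero]; exact WithZero.exp_lt_exp.mpr (by norm_num))
  haveI : EK.IsElliptic := by rw [hEK, WeierstrassCurve.baseChange]; infer_instance
  obtain ⟨D, hD⟩ : ∃ D : VariableChange K, E.localMinimalModel v = D • EK := ⟨_, rfl⟩
  -- the node-tangent quadratic of the integral model is the image of the integer one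
  set ψ : ℤ →+* IsLocalRing.ResidueField O := (IsLocalRing.residue O).comp (algebraMap ℤ O) with hψ
  have hint : EK.integralModel O = W₀.map (algebraMap ℤ O) := integralModel_baseChange_eq_map W₀ v
  have hpoly : Polynomial.map (algebraMap O (IsLocalRing.ResidueField O))
      (C (EK.integralModel O).c₄ * X ^ 2 + C ((EK.integralModel O).a₁ * (EK.integralModel O).c₄) * X
        - C (54 * (EK.integralModel O).b₆ - 3 * (EK.integralModel O).b₂ * (EK.integralModel O).b₄ +
          (EK.integralModel O).a₂ * (EK.integralModel O).c₄)) =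
      Polynomial.map ψ (C W₀.c₄ * X ^ 2 + C (W₀.a₁ * W₀.c₄) * X
        - C (54 * W₀.b₆ - 3 * W₀.b₂ * W₀.b₄ + W₀.a₂ * W₀.c₄)) := by
    rw [hint, nodalTangents_map, Polynomial.map_map]; rfl
  unfold WeierstrassCurve.HasSplitMultiplicativeReductionAt
  rw [hasSplitMultiplicativeReduction_iff_of_isMinimal_of_eq_smul O hD EK.isUnit_Δ.ne_zero,
    hasSplitMultiplicativeReduction_iff]
  have hmEK : EK.HasMultiplicativeReduction O :=
    (hasMultiplicativeReduction_iff_of_isMinimal_of_eq_smul O hD EK.isUnit_Δ.ne_zero).mp hmult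
  -- leading coefficient nonzero in the residue field
  have hlead : ψ W₀.c₄ ≠ 0 := by
    intro h0
    have : W₀.c₄ ∈ v.asIdeal := by rw [← ker_residue_comp_algebraMap ℚ v]; exact h0
    exact hc₄ (dvd_of_intCast_mem_asIdeal v this)
  set Q : ℤ[X] := C W₀.c₄ * X ^ 2 + C (W₀.a₁ * W₀.c₄) * X
    - C (54 * W₀.b₆ - 3 * W₀.b₂ * W₀.b₄ + W₀.a₂ * W₀.c₄) with hQ
  have hQmap : Q.map ψ = C (ψ W₀.c₄) * X ^ 2 + C (ψ (W₀.a₁ * W₀.c₄)) * X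
      + C (-ψ (54 * W₀.b₆ - 3 * W₀.b₂ * W₀.b₄ + W₀.a₂ * W₀.c₄)) := by
    rw [hQ, Polynomial.map_sub, Polynomial.map_add, Polynomial.map_mul, Polynomial.map_mul, Polynomial.map_pow,
      Polynomial.map_C, Polynomial.map_C, Polynomial.map_C, Polynomial.map_X, map_neg, sub_eq_add_neg]
  have hdeg : (Q.map ψ).degree = 2 := by rw [hQmap]; exact degree_quadratic hlead
  have heval : ∀ t : ℤ, (Q.map ψ).eval (ψ t) = ψ (Q.eval t) := fun t ↦ by
    rw [eval_map, eval₂_at_apply]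
  have hQeval : ∀ t : ℤ, Q.eval t =
      W₀.c₄ * t ^ 2 + W₀.a₁ * W₀.c₄ * t - (54 * W₀.b₆ - 3 * W₀.b₂ * W₀.b₄ + W₀.a₂ * W₀.c₄) := fun t ↦ by
    simp only [hQ, eval_sub, eval_add, eval_mul, eval_C, eval_pow, eval_X]
  constructor
  · rintro ⟨_, hs⟩
    rw [hpoly] at hs
    obtain ⟨τ, hτ⟩ := hs.exists_eval_eq_zero (by rw [hdeg]; decide)
    obtain ⟨t, rfl⟩ := residue_comp_algebraMap_surjective ℚ v τ
    refine ⟨t, ?_⟩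
    rw [← hQeval]
    refine dvd_of_intCast_mem_asIdeal v ?_
    rw [← ker_residue_comp_algebraMap ℚ v, RingHom.mem_ker]
    change ψ (Q.eval t) = 0
    rw [← heval t]; exact hτ
  · rintro ⟨t, ht⟩
    refine ⟨hmEK, ?_⟩
    rw [hpoly]
    refine Splits.of_degree_eq_two hdeg (x := ψ t) ?_
    rw [heval]
    change ((IsLocalRing.residue O).comp (algebraMap ℤ O)) (Q.eval t) = 0
    rw [← RingHom.mem_ker, ker_residue_comp_algebraMap ℚ v, hQeval]
    exact intCast_mem_asIdeal_of_dvd v ht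

/-- **Completing the square**: for an odd prime `p ∤ c`, `c t² + b t − k ≡ 0` has an integer solution iff
`b² + 4ck` is a square in `ZMod p`. [folklore] -/
theorem exists_root_iff_isSquare_disc {p : ℕ} [Fact p.Prime] (hp : p ≠ 2) {c b k : ℤ} (hc : ¬ (p : ℤ) ∣ c) :
    (∃ t : ℤ, (p : ℤ) ∣ c * t ^ 2 + b * t - k) ↔ IsSquare ((b ^ 2 + 4 * c * k : ℤ) : ZMod p) := by
  have hc' : (c : ZMod p) ≠ 0 := by rwa [Ne, ZMod.intCast_zmod_eq_zero_iff_dvd]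
  have h2 : (2 : ZMod p) ≠ 0 := by
    intro h
    have h' : p ∣ 2 := (ZMod.natCast_eq_zero_iff 2 p).mp (by exact_mod_cast h)
    exact hp ((Nat.prime_dvd_prime_iff_eq Fact.out Nat.prime_two).mp h')
  have h4c : (4 * (c : ZMod p)) ≠ 0 := by
    have : (4 : ZMod p) = 2 * 2 := by norm_num
    rw [this]; exact mul_ne_zero (mul_ne_zero h2 h2) hc'
  constructor
  · rintro ⟨t, ht⟩
    refine ⟨((2 * c * t + b : ℤ) : ZMod p), ?_⟩
    have h0 : ((c * t ^ 2 + b * t - k : ℤ) : ZMod p) = 0 := (ZMod.intCast_zmod_eq_zero_iff_dvd _ _).mpr ht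
    push_cast at h0 ⊢
    linear_combination (-4 * c) * h0
  · rintro ⟨y, hy⟩
    push_cast at hy
    -- `t = (y − b) / (2c)` in `ZMod p`, lifted to `ℤ`
    obtain ⟨t, htc⟩ : ∃ t : ℤ, (t : ZMod p) = (y - b) / (2 * c) := ⟨((y - b) / (2 * c)).val, by simp⟩
    have hu : 2 * (c : ZMod p) * t + b = y := by
      rw [htc]; field_simp; ring
    refine ⟨t, (ZMod.intCast_zmod_eq_zero_iff_dvd _ _).mp ?_⟩
    push_cast
    have key : (4 * (c : ZMod p)) * (c * t ^ 2 + b * t - k) = 0 := by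
      linear_combination (2 * c * t + b + y) * hu - hy
    exact (mul_eq_zero.mp key).resolve_left h4c

end Summit.BirchSwinnertonDyer.Rank2

end
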